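import Literature.NumberTheory.Automorphic.LocalLanglandsGL
import HarnessLib

/-!
# Named fact: the local Langlands correspondence for `GL_n` with GENERIC PREIMAGES of the
indecomposable parameters (Harris–Taylor 2001, Thm. A; Henniart 2002, §2.6–2.9; Zelevinsky 1980,
Thm. 9.7)

Companion of `LocalLanglandsGL` (the six-clause property `IsLocalLanglandsGL F … d 𝓔 rec` and the
named fact `localLanglands_gl`: existence of such a family `rec` + Henniart's 1993 uniqueness on
supercuspidal classes).  The existence half of `localLanglands_gl` forgets WHERE the witness sends
the classes; this file records the printed existence theorem together with the one piece of image
information that the rigidity of PINNED local Langlands data needs (summit `Langlands`, items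
stmt-Langlands-17925 / 18745: two six-clause families normalised against THE Artin maps agree on
every GENERIC class — the probes of the induction over ranks are the indecomposable parameters of
smaller dimension, which must be parameters of GENERIC representations under the comparison family).

Printed content.  Harris–Taylor 2001, Thm. A: the correspondence `rec_F` exists for every `n`, is
bijective, is local class field theory for `n = 1`, preserves `L`- and `ε`-factors of pairs, twists
and central characters (hence the six clauses, whose pair clauses are the generic sub-case).
Henniart 2002, §2.6–2.9 (the extended correspondence `π : G → A` of Thm. 1.5, built on Zelevinsky
1980, 9.3): the INDECOMPOSABLE Frobenius-semisimple parameters are the `ρ ⊗ St_m` with `ρ`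
irreducible (§2.3), and `π(ρ ⊗ St_m) = St_m(π⁰(ρ))` is the generalised Steinberg representation —
the unique irreducible quotient of `i(π⁰ρ, νπ⁰ρ, …, ν^{m-1}π⁰ρ)`, essentially square-integrable
(§2.6–2.7; for `m = 1` the supercuspidal `π⁰(ρ)` itself).  Essentially square-integrable
representations of `GL_m(F)` are generic (Zelevinsky 1980, Thm. 9.7: `⟨a⟩` is non-degenerate iff
the segments of `a` are pairwise unlinked — a single segment qualifies; Jacquet 1977; for
supercuspidal ones Gelfand–Kazhdan 1975, the tree's `isGeneric_of_isSupercuspidal`), and genericity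
does not depend on the non-trivial character `ψ` (the tree's PROVED
`IsGeneric.of_isContinuousNontrivial_holds`), so "generic for every continuous non-trivial `ψ`" and
"generic for one" are the same condition.

## Deliberately NOT here

* the full image statement (`rec⁻¹` of the irreducible parameters = the supercuspidal classes,
  of the indecomposable ones = the essentially square-integrable classes): the tree has no
  predicate for "essentially square-integrable"; only genericity of the preimage is recorded;
* uniqueness (that is `localLanglands_gl`, Henniart 1993) and the discharge `…_holds`
  (Harris–Taylor's construction).
-/

noncomputable section

open scoped MatrixGroups

namespace Literature.NumberTheory.Automorphic

open GaloisRepresentations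

/-- **The local Langlands correspondence for `GL_n(F)` exists, and every indecomposable
Frobenius-semisimple parameter is the parameter of a GENERIC representation** (named fact,
D-0014).  For a non-archimedean local field `F`, a local Artin datum `d` and a system of local
constants `𝓔` with `𝓔.artin F = d` whose Artin data are THE canonical ones at every finite
extension (`(𝓔.artin E).IsCanonical`; so `d` is the Artin map of class field theory, Harris–Taylor's
normalisation "uniformiser ↔ geometric Frobenius"), there is a family
`rec_n : Irr(GL_n(F)) → {Frobenius-semisimple n-dimensional Weil–Deligne representations}/≅`
with the six-clause property `IsLocalLanglandsGL F … d 𝓔 rec` (Harris–Taylor 2001, Thm. A: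
bijective, class field theory for `n = 1`, `L`/`ε` of pairs, twists, central characters) such
that for every `n ≥ 1` and every INDECOMPOSABLE Frobenius-semisimple `φ` on `ℂⁿ` — i.e.
`φ ≅ ρ ⊗ St_m` with `ρ` irreducible (Henniart 2002, §2.3) — the class of `φ` is `rec_n [π]` for an
irreducible smooth `π` generic for every continuous non-trivial `ψ`: `π = St_m(π⁰(ρ))`, the
generalised Steinberg representation (Henniart 2002, §2.6–2.7 and §2.9, after Zelevinsky 1980,
9.3), which is essentially square-integrable, hence generic (Zelevinsky 1980, Thm. 9.7; for
`m = 1` the supercuspidal `π⁰(ρ)`, Gelfand–Kazhdan 1975), for every `ψ` (independence of `ψ`: the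
tree's proved `IsGeneric.of_isContinuousNontrivial_holds`).  The `LocalGaloisGroup` /
`LocalConstants` named facts are threaded as the explicit hypotheses `hmul huniq hn hex hns` of
`IsLocalLanglandsGL` (D-0014).
[cite: HarrisTaylorAMS2001, Thm. A] [cite: HenniartBSMF2002, §2.3, §2.6–2.7, §2.9]
[cite: Zelevinsky1980, Thm. 9.3 and Thm. 9.7] -/
def localLanglands_gl_exists_isGeneric_preimage (F : Type) [Field F] [ValuativeRel F]
    [TopologicalSpace F] [IsNonarchimedeanLocalField F] : Prop :=
  ∀ (hmul : IsFrobPow.mul (F := F)) (huniq : IsFrobPow.unique (F := F))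
    (hn : absInertia_normal F) (hex : exists_isFrobPow (F := F))
    (hns : WeilGroup.exists_subgroup_le_inertia_isOpen_of_continuous (F := F))
    (d : LocalArtinData F) (𝓔 : LocalEpsilonSystem F), 𝓔.artin F = d →
    (∀ (E : Type) [Field E] [ValuativeRel E] [TopologicalSpace E] [IsNonarchimedeanLocalField E]
      [Algebra F E] [FiniteDimensional F E], (𝓔.artin E).IsCanonical) →
    ∃ rec : ∀ n : ℕ, IrrClass (GL (Fin n) F) → Quotient (frobSemisimpleWDSetoid F n),
      IsLocalLanglandsGL F hmul huniq hn hex hns d 𝓔 rec ∧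
      ∀ (n : ℕ), 0 < n → ∀ (φ : WeilDeligneRep F ℂ (Fin n → ℂ)) (hφ : φ.IsFrobSemisimple),
        φ.IsIndecomposable → ∃ π : SmoothIrrep (GL (Fin n) F),
          (∀ ψ : AddChar F Circle, ψ.IsContinuousNontrivial → IsGeneric π.ρ ψ) ∧
            rec n (IrrClass.mk π) = Quotient.mk (frobSemisimpleWDSetoid F n) ⟨φ, hφ⟩

/-- The fact with generic preimages implies the existence half of `localLanglands_gl` for the same
normalising pair (forget the image information). [folklore] -/
theorem exists_isLocalLanglandsGL_of_exists_isGeneric_preimage {F : Type} [Field F] [ValuativeRel F]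
    [TopologicalSpace F] [IsNonarchimedeanLocalField F]
    (h : localLanglands_gl_exists_isGeneric_preimage F)
    (hmul : IsFrobPow.mul (F := F)) (huniq : IsFrobPow.unique (F := F))
    (hn : absInertia_normal F) (hex : exists_isFrobPow (F := F))
    (hns : WeilGroup.exists_subgroup_le_inertia_isOpen_of_continuous (F := F))
    (d : LocalArtinData F) (𝓔 : LocalEpsilonSystem F) (hd : 𝓔.artin F = d)
    (h𝓔 : ∀ (E : Type) [Field E] [ValuativeRel E] [TopologicalSpace E] [IsNonarchimedeanLocalField E]
      [Algebra F E] [FiniteDimensional F E], (𝓔.artin E).IsCanonical) :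
    ∃ rec : ∀ n : ℕ, IrrClass (GL (Fin n) F) → Quotient (frobSemisimpleWDSetoid F n),
      IsLocalLanglandsGL F hmul huniq hn hex hns d 𝓔 rec :=
  (h hmul huniq hn hex hns d 𝓔 hd h𝓔).imp fun _ h' => h'.1

end Literature.NumberTheory.Automorphic

end
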